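import Summits.QuantumFields.GaugeBoot.Rows.RedEnc
import Summits.QuantumFields.GaugeBoot.Rows.RedEncSparse
import HarnessLib

/-!
# Gauge-boot: reduction-step kit of the kz-L2-H-3D problems (1203 variables): congruence lemma over lean3's entry tables

Cell `pub-gaugeboot` (HOME `run/shared/lean/pub/pub-gaugeboot/`), seat lean1 (torus layer for rows C1–C2 (and C41–C50) = the certified
kz-L2-H-3D windows: label set, raw blocks, class/witness tables, the reduction identity, per-β bindings).

HONEST FRAMING (page 1 of every file of this cell): certified bounds on lattice expectations at STATED coupling,
gauge group, dimension and torus size; NOT a mass gap, NOT a continuum limit, NOT a string tension, NOT large `N`.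
The venture is explicitly NOT Yang–Mills-summit-bearing (barriers `FixedCouplingUltralocality`,
`PerturbativeInvisibility`).

The β- and data-independent part of `KZL2HD3Red`, split out so that it elaborates before the family's tables are built:
`yN` (assignment extended by `0`), `evalComb_eq_eval` (lean3's `Sparse.evalComb` = the cell's `GLYZc2D3.SVec.eval`),
`sparse_ent_comm`, `posSemidef_of_table` (a symmetric relabelling of a PSD quadratic form is a PSD matrix) and the
congruence step `entryMatrix_posSemidef`: radix checks `RedEnc.encCheck 20 1203` on `i ≤ j` + raw PSD ⇒ lean3's block PSD.
-/

noncomputable section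

open Literature.MathematicalPhysics.QuantumFieldTheory
open Matrix
open Summit.QuantumFields.GaugeBoot.GLYZc2D3 (SVec)

namespace Summit.QuantumFields.GaugeBoot

namespace KZL2HD3

/-- A variable assignment extended by `0` beyond the 1203 columns. -/
def yN (y : Fin 1203 → ℝ) (v : ℕ) : ℝ := if h : v < 1203 then y ⟨v, h⟩ else 0

/-- `yN` on a column index. -/
@[simp] theorem yN_val (y : Fin 1203 → ℝ) (v : Fin 1203) : yN y v.val = y v := by simp [yN, v.isLt]

/-- lean3's entry evaluation is the sparse-form evaluation at `yN y`. -/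
theorem evalComb_eq_eval (y : Fin 1203 → ℝ) : ∀ l : SVec, Certificates.Sparse.evalComb l y = GLYZc2D3.SVec.eval (yN y) l
  | [] => by simp [GLYZc2D3.SVec.eval]
  | (w, c) :: t => by
    rw [Certificates.Sparse.evalComb_cons, GLYZc2D3.SVec.eval_cons, evalComb_eq_eval y t]
    simp only [yN]
    split_ifs <;> simp

/-- A real matrix whose entries are a symmetric relabelling of a PSD quadratic form is positive semidefinite (1203-variable copy). -/
theorem posSemidef_of_table {n : ℕ} (yv : Fin 1203 → ℝ) (cls : ℕ → ℕ → Fin 1203) (hsymm : ∀ i j, cls i j = cls j i)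
    (hq : ∀ c : Fin n → ℝ, 0 ≤ ∑ i : Fin n, ∑ j : Fin n, c i * c j * yv (cls i j)) :
    (Matrix.of fun i j : Fin n => yv (cls i j)).PosSemidef := by
  refine Matrix.PosSemidef.of_dotProduct_mulVec_nonneg ?_ fun x => ?_
  · ext i j
    simp only [Matrix.conjTranspose_apply, Matrix.of_apply, star_trivial, hsymm i j]
  · have h := hq x
    simp only [dotProduct, Matrix.mulVec, Matrix.of_apply, star_trivial, Finset.mul_sum] at h ⊢
    exact h.trans_eq (Finset.sum_congr rfl fun i _ => Finset.sum_congr rfl fun j _ => by ring)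

/-- **Congruence step (generic in the block)**: if the sparse columns `cols` have raw indices `< n`, the radix check holds
for `i ≤ j` against the entry table `entf` (symmetric), and the raw class-table matrix `(y (cls a b))_{a,b<n}` is PSD,
then the `m × m` matrix `(evalComb (entf i j) y)_{i,j}` is PSD — it is `Yᴴ · raw · Y` (kz-L2-H-3D version, 1203 variables). -/
theorem entryMatrix_posSemidef {n m : ℕ} (y : Fin 1203 → ℝ) (cls : ℕ → ℕ → Fin 1203) (cols : ℕ → SVec)
    (entf : ℕ → ℕ → SVec) (hcols : ∀ i < m, ∀ p ∈ cols i, p.1 < n) (hsymm : ∀ i j, entf i j = entf j i)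
    (hcls : ∀ a b, cls a b = cls b a)
    (hid : ∀ i j : Fin m, i.val ≤ j.val → RedEnc.encCheck 20 1203 (cols i) (cols j) (fun a b => (cls a b).val) (entf i j) = true)
    (hraw : (Matrix.of fun a b : Fin n => y (cls a b)).PosSemidef) :
    (Matrix.of fun i j : Fin m => Certificates.Sparse.evalComb (entf i.val j.val) y).PosSemidef := by
  set Y : Matrix (Fin n) (Fin m) ℝ := Matrix.of fun a i => (GLYZc2D3.SVec.coeff (cols i.val) a.val : ℝ) with hY
  have hlt : ∀ a b, (cls a b).val < 1203 := fun a b => (cls a b).isLt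
  have hexp : ∀ i j : Fin m, GLYZc2D3.SVec.eval (yN y) (GLYZc2D3.SVec.expand (cols i.val) (cols j.val) fun a b => (cls a b).val) =
      ∑ b : Fin n, ∑ a : Fin n, (GLYZc2D3.SVec.coeff (cols i.val) a.val : ℝ) * ((GLYZc2D3.SVec.coeff (cols j.val) b.val : ℝ) * y (cls a b)) := by
    intro i j
    rw [GLYZc2D3.SVec.eval_expand, GLYZc2D3.SVec.eval_eq_sum_fin (cols i.val) _ (hcols i.val i.isLt)]
    simp only [GLYZc2D3.SVec.eval_eq_sum_fin (cols j.val) _ (hcols j.val j.isLt), Finset.mul_sum]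
    rw [Finset.sum_comm]
    refine Finset.sum_congr rfl fun b _ => Finset.sum_congr rfl fun a _ => ?_
    rw [show ((cls a.val b.val).val : ℕ) = (cls a b).val from rfl, yN_val]
  have hsym2 : ∀ i j : Fin m, (∑ b : Fin n, ∑ a : Fin n, (GLYZc2D3.SVec.coeff (cols i.val) a.val : ℝ) * ((GLYZc2D3.SVec.coeff (cols j.val) b.val : ℝ) * y (cls a b))) =
      ∑ b : Fin n, ∑ a : Fin n, (GLYZc2D3.SVec.coeff (cols j.val) a.val : ℝ) * ((GLYZc2D3.SVec.coeff (cols i.val) b.val : ℝ) * y (cls a b)) := by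
    intro i j
    rw [Finset.sum_comm]
    exact Finset.sum_congr rfl fun a _ => Finset.sum_congr rfl fun b _ => by rw [hcls b a]; ring
  have key : (Matrix.of fun i j : Fin m => Certificates.Sparse.evalComb (entf i.val j.val) y) =
      Yᴴ * (Matrix.of fun a b : Fin n => y (cls a b)) * Y := by
    ext i j
    have hmul : (Yᴴ * (Matrix.of fun a b : Fin n => y (cls a b)) * Y) i j =
        ∑ b : Fin n, ∑ a : Fin n, (GLYZc2D3.SVec.coeff (cols i.val) a.val : ℝ) * ((GLYZc2D3.SVec.coeff (cols j.val) b.val : ℝ) * y (cls a b)) := by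
      simp only [Matrix.mul_apply, Matrix.conjTranspose_apply, Matrix.of_apply, star_trivial, hY, Finset.sum_mul]
      exact Finset.sum_congr rfl fun b _ => Finset.sum_congr rfl fun a _ => by ring
    rw [hmul, Matrix.of_apply, evalComb_eq_eval]
    rcases le_total i.val j.val with hij | hji
    · rw [RedEnc.eval_eq_of_encCheck hlt (hid i j hij), hexp]
    · rw [hsymm, RedEnc.eval_eq_of_encCheck hlt (hid j i hji), hexp, hsym2]
  rw [key]
  exact hraw.conjTranspose_mul_mul_same Y

end KZL2HD3

end Summit.QuantumFields.GaugeBoot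

end
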